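import Literature.NumberTheory.Rogawski1990.ArchExplicitTransferFactor
import HarnessLib

/-!
# `G`-regularity at a complex place for Rogawski's explicit archimedean factor: `χ_{g_w}(γ₂,w) ≠ 0`, `τ(γ_H) ≠ 0`, `D_{G∕H,∞}(γ_H) ≠ 0`
# (node N2∞ of `F0/P3a/T6b-TREE.md`, part 1 of 2: the `γ_H`-side factors of `Δ″_∞ = τ · D_{G∕H,∞} · Π_w κ_w`)

Topic `NumberTheory/Rogawski1990`; namespace `Literature.NumberTheory.Rogawski1990`.  THEOREMS ONLY (no `def`, no named fact, no `sorry`, no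
instance, no notation); sibling of ★ `ArchExplicitTransferFactor.lean` (typ-T6b, ED. 2 p826446), imports it only.  Cell `pub/hodgecm-mathlib`, F0∕P3a,
typer topic T6, seat B-p12 (g25).  HONEST LABEL: HC_CM is proved only modulo the printed citations («named inputs remaining 2») until rung 0 closes;
this file proves nothing of them.  Sequel: `ArchExplicitTransferFactorNondegenerate.lean` (`κ_w ≠ 0` and the assembly `IsArchNondegenerate …`).

THE MATHEMATICS (Rogawski 1990 §4.3 p. 42 «`γ′ ∈ H` is `G`-regular if `A_{G∕H}(γ′)` is a regular class in `G`»; §4.9 pp. 54–55 «`|Δ_{G∕H}| = D_{G∕H}`»).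
`G`-regular = the characteristic polynomial of `ι(γ_H)` is separable over `L ⊗ ℝ` (★ `IsArchGRegular` ∕ ★ `IsRegularElt`).  At a complex place `w` the
pattern `ι(γ_H)_w = g_w ⊕ γ₂,w` (★ `coe_endoGL`) has characteristic polynomial `χ_{g_w} · (X − γ₂,w)` (Mathlib `charpoly_reindex`,
`charpoly_fromBlocks_zero₁₂`); a separable polynomial is squarefree, so **`χ_{g_w}(γ₂,w) ≠ 0`** (`evalC_eval_archCharpolyTwo_ne_zero_of_isArchGRegular`).
Consequences: `χ_g(γ₂)` and `τ`'s argument `−χ_g(γ₂)·det g⁻¹` are units of `L ⊗ ℝ` (a CM field has no real place — Mathlib `IsTotallyComplex.isComplex`;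
`γ₂ = det` of an element of `GL₁` is a unit), ★ `archHeckeValue μ` of a unit is a value of `μ` in `ℂˣ`, hence **`τ(γ_H) ≠ 0`**; **`D_{G∕H,∞}(γ_H) =
Π_w |χ_{g_w}(γ₂,w)| ≠ 0`**; and `|γ₂,w| = 1` (`U(Φ₁)`-coordinate, ★ `UnitaryGroup.archAt`), `η_w = ±1`.

## References
* [Rogawski1990] J. D. Rogawski, *Automorphic Representations of Unitary Groups in Three Variables*, Ann. of Math. Stud. 123 (1990): §4.3 p. 42
  (`G`-regular), §4.9 pp. 54–55 (`D_G`, `τ`, `|τ| = 1`, `Δ_{G∕H} = τ D_{G∕H}`), §14.6 p. 242 (`κ = ±1`).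
* [PlatonovRapinchuk1994] V. Platonov, A. Rapinchuk, *Algebraic Groups and Number Theory*, Academic Press (1994), §2.3 (unitary groups of hermitian forms).
-/


set_option autoImplicit false

noncomputable section

open NumberField NumberField.InfinitePlace Matrix Polynomial
open Literature.NumberTheory.GaloisRepresentations
open scoped MatrixGroups ComplexOrder

namespace Literature.NumberTheory.Rogawski1990

open Literature.NumberTheory.Automorphic

/-! ## §1 `G`-regularity at a complex place: `χ_{g_w}(γ₂,w) ≠ 0`; `τ ≠ 0`, `D_{G∕H,∞} ≠ 0`, `|γ₂,w| = 1`, `η_w ≠ 0` -/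


section Place

variable (L : Type) [Field L] [NumberField L] [IsCMField L] (H' : Matrix (Fin 3) (Fin 3) L)
  (a : ↥(UnitaryGroup.arch (↥(maximalRealSubfield L)) L (IsCMField.complexConj L) 2
      (Matrix.of fun i j : Fin 2 => if i.val + j.val + 1 = 2 then (1 : L) else 0)) ×
    ↥(UnitaryGroup.arch (↥(maximalRealSubfield L)) L (IsCMField.complexConj L) 1
      (Matrix.of fun i j : Fin 1 => if i.val + j.val + 1 = 1 then (1 : L) else 0)))
  (b : ↥(UnitaryGroup.arch (↥(maximalRealSubfield L)) L (IsCMField.complexConj L) 3 H'))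
  (w : {w : InfinitePlace L // IsComplex w})

/-- **`χ_{g_w}(γ₂,w)` expanded**: `w(χ_g(γ₂)) = γ₂,w² − tr(g_w) γ₂,w + det(g_w)` (Mathlib `charpoly_fin_two`). [cite: Rogawski1990, §4.9 p. 55] -/
theorem evalC_eval_archCharpolyTwo_archGammaTwo :
    UnitaryGroup.evalC L w ((archCharpolyTwo L a).eval (archGammaTwo L a)) =
      UnitaryGroup.evalC L w (archGammaTwo L a) * UnitaryGroup.evalC L w (archGammaTwo L a) -
        ((((a.1 : ↥(UnitaryGroup.arch (↥(maximalRealSubfield L)) L (IsCMField.complexConj L) 2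
            (Matrix.of fun i j : Fin 2 => if i.val + j.val + 1 = 2 then (1 : L) else 0))) :
            GL (Fin 2) (mixedEmbedding.mixedSpace L)) : Matrix (Fin 2) (Fin 2) (mixedEmbedding.mixedSpace L)).map
            (UnitaryGroup.evalC L w)).trace * UnitaryGroup.evalC L w (archGammaTwo L a) +
        ((((a.1 : ↥(UnitaryGroup.arch (↥(maximalRealSubfield L)) L (IsCMField.complexConj L) 2
            (Matrix.of fun i j : Fin 2 => if i.val + j.val + 1 = 2 then (1 : L) else 0))) :
            GL (Fin 2) (mixedEmbedding.mixedSpace L)) : Matrix (Fin 2) (Fin 2) (mixedEmbedding.mixedSpace L)).map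
            (UnitaryGroup.evalC L w)).det := by
  rw [← Polynomial.eval₂_at_apply, ← Polynomial.eval_map, archCharpolyTwo, ← Matrix.charpoly_map, Matrix.charpoly_fin_two]
  simp only [eval_add, eval_sub, eval_mul, eval_pow, eval_X, eval_C]
  ring

/-- **Regularity unpacked at `w`: `χ_{g_w}(γ₂,w) ≠ 0`** — the characteristic polynomial of `ι(γ_H)_w = (g_w ⊕ γ₂,w)` is `χ_{g_w}·(X − γ₂,w)`, separable
(hence squarefree) when `γ_H` is `G`-regular, so `X − γ₂,w` does not divide `χ_{g_w}`. [cite: Rogawski1990, §4.3 p. 42; §4.9 p. 55] -/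
theorem evalC_eval_archCharpolyTwo_ne_zero_of_isArchGRegular (hreg : IsArchGRegular L a) :
    UnitaryGroup.evalC L w ((archCharpolyTwo L a).eval (archGammaTwo L a)) ≠ 0 := by
  set φ := UnitaryGroup.evalC L w with hφ
  set g := (((a.1 : ↥(UnitaryGroup.arch (↥(maximalRealSubfield L)) L (IsCMField.complexConj L) 2
      (Matrix.of fun i j : Fin 2 => if i.val + j.val + 1 = 2 then (1 : L) else 0))) :
        GL (Fin 2) (mixedEmbedding.mixedSpace L)) : Matrix (Fin 2) (Fin 2) (mixedEmbedding.mixedSpace L)) with hg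
  set U := (((a.2 : ↥(UnitaryGroup.arch (↥(maximalRealSubfield L)) L (IsCMField.complexConj L) 1
      (Matrix.of fun i j : Fin 1 => if i.val + j.val + 1 = 1 then (1 : L) else 0))) :
        GL (Fin 1) (mixedEmbedding.mixedSpace L)) : Matrix (Fin 1) (Fin 1) (mixedEmbedding.mixedSpace L)) with hU
  -- separability of `charpoly ι(γ_H)` over `L ⊗ ℝ`, pushed to the place `w`
  have hsep : ((((endoEmbArch L a : ↥(UnitaryGroup.arch (↥(maximalRealSubfield L)) L (IsCMField.complexConj L) 3
      (Matrix.of fun i j : Fin 3 => if i.val + j.val + 1 = 3 then (1 : L) else 0))) :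
        GL (Fin 3) (mixedEmbedding.mixedSpace L)) : Matrix (Fin 3) (Fin 3) (mixedEmbedding.mixedSpace L)).charpoly).Separable := hreg
  have hsepw := hsep.map (f := φ)
  rw [← Matrix.charpoly_map, coe_endoEmbArch, coe_endoGL] at hsepw
  dsimp only at hsepw
  rw [Matrix.reindex_apply, ← Matrix.submatrix_map, ← Matrix.reindex_apply, Matrix.charpoly_reindex, Matrix.fromBlocks_map,
    Matrix.map_zero _ (map_zero φ), Matrix.map_zero _ (map_zero φ), Matrix.charpoly_fromBlocks_zero₁₂, ← hg, ← hU] at hsepw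
  have hUc : (U.map φ).charpoly = X - C (φ (U 0 0)) := by
    rw [Matrix.charpoly, Matrix.det_fin_one, Matrix.charmatrix_apply_eq, Matrix.map_apply]
  rw [hUc] at hsepw
  -- `w(χ_g(γ₂)) = χ_{g_w}(γ₂,w)`
  have hev : φ ((archCharpolyTwo L a).eval (archGammaTwo L a)) = ((g.map φ).charpoly).eval (φ (U 0 0)) := by
    rw [← Polynomial.eval₂_at_apply, ← Polynomial.eval_map, archCharpolyTwo, ← Matrix.charpoly_map]
    rfl
  intro h0
  rw [hev] at h0
  have hdvd : (X - C (φ (U 0 0))) * (X - C (φ (U 0 0))) ∣ (g.map φ).charpoly * (X - C (φ (U 0 0))) :=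
    mul_dvd_mul_right (dvd_iff_isRoot.2 h0) _
  exact not_isUnit_X_sub_C (φ (U 0 0)) (hsepw.squarefree _ hdvd)

/-- A CM field has no real place, so the real coordinates of `L ⊗ ℝ` impose nothing: **`χ_g(γ₂)` is a unit of `L ⊗ ℝ`** for `G`-regular `γ_H`.
[cite: Rogawski1990, §4.9 p. 55] -/
theorem isUnit_eval_archCharpolyTwo_of_isArchGRegular (hreg : IsArchGRegular L a) :
    IsUnit ((archCharpolyTwo L a).eval (archGammaTwo L a)) := by
  rw [Prod.isUnit_iff, Pi.isUnit_iff, Pi.isUnit_iff]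
  refine ⟨fun v => absurd v.2 (not_isReal_iff_isComplex.mpr (IsTotallyComplex.isComplex v.1)), fun v => ?_⟩
  rw [isUnit_iff_ne_zero]
  exact evalC_eval_archCharpolyTwo_ne_zero_of_isArchGRegular L a v hreg

/-- **`γ₂` is a unit** (the determinant of an element of `GL₁(L ⊗ ℝ)`). [cite: Rogawski1990, §4.9 p. 55] -/
theorem isUnit_archGammaTwo : IsUnit (archGammaTwo L a) := by
  unfold archGammaTwo
  rw [← Matrix.det_fin_one (((a.2 : ↥(UnitaryGroup.arch (↥(maximalRealSubfield L)) L (IsCMField.complexConj L) 1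
      (Matrix.of fun i j : Fin 1 => if i.val + j.val + 1 = 1 then (1 : L) else 0))) :
        GL (Fin 1) (mixedEmbedding.mixedSpace L)) : Matrix (Fin 1) (Fin 1) (mixedEmbedding.mixedSpace L))]
  exact Matrix.isUnits_det_units _

/-- **`τ`'s argument `−χ_g(γ₂)·det g⁻¹` is a unit** for `G`-regular `γ_H`. [cite: Rogawski1990, §4.9 p. 55] -/
theorem isUnit_archTauArg_of_isArchGRegular (hreg : IsArchGRegular L a) : IsUnit (archTauArg L a) := by
  unfold archTauArg
  exact ((isUnit_eval_archCharpolyTwo_of_isArchGRegular L a hreg).neg).mul (Matrix.isUnits_det_units _)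

omit [IsCMField L] in
/-- `μ_∞` at a unit is a value of `μ` in `ℂˣ`, hence non-zero. [cite: Rogawski1990, §4.9 p. 55] -/
theorem archHeckeValue_ne_zero_of_isUnit (μ : HeckeCharacter L) {x : mixedEmbedding.mixedSpace L} (hx : IsUnit x) :
    archHeckeValue L μ x ≠ 0 := by
  classical
  unfold archHeckeValue
  rw [dif_pos hx]
  exact Units.ne_zero _

/-- **`τ(γ_H) ≠ 0`** for `G`-regular `γ_H` («`|τ(γ)| = 1`»). [cite: Rogawski1990, §4.9 p. 55] -/
theorem archTau_ne_zero_of_isArchGRegular (μ : HeckeCharacter L) (hreg : IsArchGRegular L a) : archTau L a μ ≠ 0 :=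
  mul_ne_zero (archHeckeValue_ne_zero_of_isUnit L μ (isUnit_archGammaTwo L a))
    (inv_ne_zero (archHeckeValue_ne_zero_of_isUnit L μ (isUnit_archTauArg_of_isArchGRegular L a hreg)))

open scoped Classical in
/-- **`D_{G∕H,∞}(γ_H) ≠ 0`** for `G`-regular `γ_H` (`D_G(γ) ≠ 0` iff `γ` is regular). [cite: Rogawski1990, §4.9 p. 55] -/
theorem archWeylRatio_ne_zero_of_isArchGRegular (hreg : IsArchGRegular L a) : archWeylRatio L a ≠ 0 := by
  unfold archWeylRatio
  exact Finset.prod_ne_zero_iff.2 fun v _ => norm_ne_zero_iff.2 (evalC_eval_archCharpolyTwo_ne_zero_of_isArchGRegular L a v hreg)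

omit [NumberField L] [IsCMField L] in
open scoped Classical in
/-- `η_w(H′) = ±1 ≠ 0`. [cite: Rogawski1990, §14.6 p. 242] -/
theorem archMajoritySign_ne_zero : archMajoritySign L H' w ≠ 0 := by
  unfold archMajoritySign
  split_ifs <;> decide

/-- **`|γ₂,w| = 1`**: the `U(Φ₁)`-coordinate of `γ_H` is unitary at every complex place. [cite: Rogawski1990, §4.9 p. 55] -/
theorem star_evalC_archGammaTwo_mul_self :
    starRingEnd ℂ (UnitaryGroup.evalC L w (archGammaTwo L a)) * UnitaryGroup.evalC L w (archGammaTwo L a) = 1 := by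
  have hmem := (UnitaryGroup.archAt (↥(maximalRealSubfield L)) L (IsCMField.complexConj L) 1
      (Matrix.of fun i j : Fin 1 => if i.val + j.val + 1 = 1 then (1 : L) else 0) w
      (UnitaryGroup.complexConj_smul_infinitePlace L w.1) (IsCMField.complexConj_ne_one L) a.2).2
  rw [UnitaryGroup.mem_archLocal_iff_conjTranspose, UnitaryGroup.coe_archAt, Matrix.GeneralLinearGroup.val_map_apply] at hmem
  unfold archGammaTwo
  simpa [Matrix.mul_apply, Matrix.conjTranspose_apply, Matrix.map_apply] using congrFun (congrFun hmem 0) 0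

end Place

end Literature.NumberTheory.Rogawski1990

end
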